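import Summits.CriticalPhenomena.PercolationContinuityZ3.Theorems.PercNearOneGluingNoHeavyLowerTailSahiC3CombCubeFive
import Summits.CriticalPhenomena.PercolationContinuityZ3.Theorems.PercNearOneGluingNoHeavyLowerTailSahiGridPatternCombined
import Summits.CriticalPhenomena.PercolationContinuityZ3.Theorems.PercNearOneGluingNoHeavyLowerTailSahiPatternPosFour

/-!
# The first open cell `(5,3)`: `CombinedAlternative 4 → PatternPos 5` — the weakest obligation of the rounding/flattening programme now
# suffices alone (its other inputs `ResolvedPos 5` and `PatternPos 4` are kernel theorems)

Support file (cell `prim-sahi`, seat `prim-sahi-typer` gen 33; `--supports stmt-CriticalPhenomena-4575`; proposed `--computational`: closure =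
standard axioms + the pre-existing `native_decide` axioms behind `SahiC3CombCube.resolvedPos_five` (eight `colourCheck_five` chunks, typer gen 27)
and `SahiGridPattern.patternPos_four` (twenty `Pair43.chunkCheck_20_r` chunks, typer gen 32); no evaluation here, no `sorry`).

P1 gen 13 (`…SahiGridPatternCombined`): `CombinedAlternative n → ResolvedPos (n+1) → PatternPos n → PatternPos (n+1)`, where
`CombinedAlternative n` asks, of every up-set triple of `[3]^{n+1}` with an unresolved axis, for a non-increasing simultaneous rounding on an
unresolved axis OR a dominating flattening — implied by `RoundingAlternative (n+1)` and by `FlatteningDomination n`, the weakest obligation of the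
programme.  At `n = 4` the second and third inputs are now kernel theorems (`SahiC3CombCube.resolvedPos_five`, this generation;
`patternPos_four`, gen 32), so:

* **`patternPos_five_of_combinedAlternative'`**: `CombinedAlternative 4 → PatternPos 5`;
* `patternPos_five_of_flatteningDomination`: `FlatteningDomination 4 → PatternPos 5` (from `patternPos_four` alone);
* under `CombinedAlternative 4`: Kahn's Conjecture 5 / Sahi's `C₃` for every product weight on every grid `[K+1]^5`
  (`liebSahi_grid_five_of_combinedAlternative`), every FKG weight on `[b+1]^5` (`fkg_grid_five_of_combinedAlternative`), Lieb–Sahi's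
  Conjecture 1.1 on `[0,1]^5` at order `3` (`liebSahiContinuum_five_three_of_combinedAlternative`).
HONEST LABEL: `CombinedAlternative 4` (and its per-axis forms are FALSE at `d = 4`, P1 gen 13 census), `PatternPos 5`, Kahn's Conjecture 5 and
Sahi's `C₃` remain OPEN; nothing here asserts them. [this work]
-/

namespace Summit.CriticalPhenomena.PercolationContinuityZ3.Theorems.SahiGridPattern

open Finset Literature.Probability.LatticeModels Literature.Combinatorics.Sahi2008
open SahiC3CombCube (resolvedPos_five)

/-- **`CombinedAlternative 4 → PatternPos 5`**: the weakest obligation of the programme (a non-increasing rounding on an unresolved axis OR a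
dominating flattening, for every up-set triple of `[3]^5` with an unresolved axis) now suffices ALONE for the first open cell. [this work]
[computational] -/
theorem patternPos_five_of_combinedAlternative' (h : CombinedAlternative 4) : PatternPos 5 :=
  patternPos_five_of_combinedAlternative h resolvedPos_five patternPos_four

/-- `FlatteningDomination 4 → PatternPos 5` (from `patternPos_four` alone; recorded for completeness). [this work] [computational] -/
theorem patternPos_five_of_flatteningDomination (h : FlatteningDomination 4) : PatternPos 5 :=
  patternPos_succ_of_flatteningDomination h patternPos_four

/-- Under `CombinedAlternative 4`: **Kahn's Conjecture 5 / Sahi's `C₃` in dimension 5** — every product probability weight on every grid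
`[K+1]^5` is Sahi-positive of order 3. [this work] [computational] -/
theorem liebSahi_grid_five_of_combinedAlternative (h : CombinedAlternative 4) :
    ∀ (K : ℕ) (g : Fin 5 → Fin (K + 1) → ℝ), (∀ i u, 0 ≤ g i u) → (∀ i, ∑ u, g i u = 1) →
      SahiPositive (fun ω : Fin 5 → Fin (K + 1) => ∏ i, g i (ω i)) 3 :=
  liebSahi_grid_of_patternPos (patternPos_five_of_combinedAlternative' h)

/-- Under `CombinedAlternative 4`: every FKG probability weight on every grid `[b+1]^5` is Sahi-positive of order 3. [this work] [computational] -/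
theorem fkg_grid_five_of_combinedAlternative (h : CombinedAlternative 4) :
    ∀ (b : ℕ) (μ : (Fin 5 → Fin (b + 1)) → ℝ), IsFKGMeasure μ → SahiPositive μ 3 :=
  fkg_grid_of_patternPos (patternPos_five_of_combinedAlternative' h)

/-- Under `CombinedAlternative 4`: Lieb–Sahi's Conjecture 1.1 on `[0,1]^5` at order 3. [this work] [computational] -/
theorem liebSahiContinuum_five_three_of_combinedAlternative (h : CombinedAlternative 4) : LiebSahiContinuum 5 3 :=
  liebSahiContinuum_of_patternPos (patternPos_five_of_combinedAlternative' h)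

end Summit.CriticalPhenomena.PercolationContinuityZ3.Theorems.SahiGridPattern
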